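import Summits.NavierStokesRegularity.FluidComputer.SwirlTypeIBarrier
import Literature.Analysis.FluidPDE.SereginSverakMeridionalCubic
import HarnessLib

/-!
# Type-I meridional velocity forces Type-I swirl, and the full Type-I bound, near the axis

Cell `ns-blowup`, seat `ns-blowup-ecbridge-2` (g13). Proof file (NO definitions, no named facts,
no `sorry`): the two consequences of the swirl barrier `exists_swirl_le_swirlBarrier`
(`SwirlTypeIBarrier.lean`) obtained by centring it at the FOOT `(0, 0, x₂)` of each point `x` on
the axis (`|x − foot| = r(x)`, `B(foot, R/2) ⊆ B(x₁, R)` for `x ∈ B(x₁, R/2)`, `x₁` on the axis).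
For a classical forced axisymmetric solution on `[t₀, T'] × (EuclideanSpace ℝ (Fin 3))`, `T' < T`, with
`|ū| ≤ C/√(T − t)` on `B(x₁, R)` (MERIDIONAL part `ū = poloidalPart u` only), `|Γ| ≤ C_Γ` on
`B̄(x₁, R)`, `|u(t₀)| ≤ V₀` on `B̄(x₁, R)`, `|f| ≤ F₀` on `B(x₁, R)`:

* `exists_swirl_le_linear_cylRadius` — a constant `K' ≥ 0` (depending on
  `ν, C, C_Γ, V₀, F₀, R, T − t₀` only) with `|Γ(t, x)| ≤ K' r/√(T − t)` on `[t₀, T'] × B(x₁, R/2)`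
  inside the parabola `r ≤ √(T − t)` (`Ψ_a(s) ≤ s`, `s² ≤ s`);
* **`exists_norm_le_typeI_of_meridionalTypeI`** — a constant `C'` with
  `|u(t, x)| ≤ C'/√(T − t)` on `[t₀, T'] × B(x₁, R/2)` for every `T' < T`: THE MERIDIONAL TYPE-I
  BOUND IMPLIES THE FULL ONE near the axis (inside the parabola by the barrier; outside it by
  `|u_θ| = |Γ|/r ≤ C_Γ/√(T − t)`), so that every local Type-I exclusion stated for the full
  velocity (Koch–Nadirashvili–Seregin–Šverák 2009 Thm 6.2, in the tree WITH the Clay force: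
  `ClayBlowup.not_localTypeI_of_isAxisymmetric_forced`) becomes one for Seregin–Šverák's
  hypothesis (1.1) on `v̄`, for classical solutions with bounded swirl and force.

WHAT THIS IS NOT: not a statement about blow-up (consumer `ClayBlowupLocalMeridionalTypeI.lean`).
References: Seregin–Šverák, Comm. PDE 34 (2009) = arXiv:0804.1803, §1 (1.1), p. 4, Thm 1.1
[cite: SereginSverak2009, §1 (1.1) and Thm 1.1]; Koch–Nadirashvili–Seregin–Šverák, Acta Math. 203
(2009), (1.8)–(1.9), Thm 6.2 [cite: KochNadirashviliSereginSverak2009, Thm 6.2].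
-/

noncomputable section

open MeasureTheory Set Function Filter Topology Metric InnerProductSpace WithLp
open scoped RealInnerProductSpace Laplacian ContDiff NNReal
open Literature.Analysis Literature.Analysis.FluidPDE

namespace Summit.NavierStokesRegularity.FluidComputer

section Meridional

/-- **TYPE-I MERIDIONAL VELOCITY FORCES TYPE-I SWIRL NEAR THE AXIS** (classical, local, with
force): there is `K' ≥ 0`, depending on `ν, C, C_Γ, V₀, F₀, R, T − t₀` only, such that for every
`T' ∈ (t₀, T)`, every classical forced solution (`ν > 0`) on `[t₀, T'] × (EuclideanSpace ℝ (Fin 3))` with axisymmetric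
velocity and force, every axis point `x₁`, under `|ū(t, x)| ≤ C/√(T − t)` on `B(x₁, R)`
(MERIDIONAL part only), `|Γ| ≤ C_Γ` on `B̄(x₁, R)`, `|u(t₀, ·)| ≤ V₀` on `B̄(x₁, R)`, `|f| ≤ F₀` on
`B(x₁, R)`: for `t ∈ [t₀, T']`, `x ∈ B(x₁, R/2)` with `r(x) ≤ √(T − t)`,
`|Γ(t, x)| ≤ K' r(x)/√(T − t)` — the barrier of `exists_swirl_le_swirlBarrier` centred at the foot
`(0,0,x₂)` of `x` (`|x − foot| = r`, `B(foot, R/2) ⊆ B(x₁, R)`), with `Ψ_a(s) ≤ s` and `s² ≤ s`.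
[cite: KochNadirashviliSereginSverak2009, §1 (1.8)–(1.9) (arXiv p. 2)] -/
theorem exists_swirl_le_linear_cylRadius {T t₀ ν C CΓ V₀ F₀ R : ℝ} (hν : 0 < ν) (ht₀T : t₀ < T)
    (hC : 0 ≤ C) (hCΓ : 0 ≤ CΓ) (hV₀ : 0 ≤ V₀) (hF₀ : 0 ≤ F₀) (hR : 0 < R) :
    ∃ K' : ℝ, 0 ≤ K' ∧
      ∀ (T' : ℝ) (v f : ℝ → (EuclideanSpace ℝ (Fin 3)) → (EuclideanSpace ℝ (Fin 3))) (q : ℝ → (EuclideanSpace ℝ (Fin 3)) → ℝ) (x₁ : (EuclideanSpace ℝ (Fin 3))), t₀ < T' → T' < T →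
        IsClassicalNSSolutionOn (Icc t₀ T') ν f v q →
        (∀ t ∈ Icc t₀ T', IsAxisymmetric (v t)) → (∀ t ∈ Icc t₀ T', IsAxisymmetric (f t)) →
        cylRadius x₁ = 0 →
        (∀ t ∈ Icc t₀ T', ∀ x ∈ ball x₁ R, ‖poloidalPart (v t) x‖ ≤ C / Real.sqrt (T - t)) →
        (∀ t ∈ Icc t₀ T', ∀ x ∈ closedBall x₁ R, |swirl (v t) x| ≤ CΓ) →
        (∀ x ∈ closedBall x₁ R, ‖v t₀ x‖ ≤ V₀) →
        (∀ t ∈ Icc t₀ T', ∀ x ∈ ball x₁ R, ‖f t x‖ ≤ F₀) →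
        ∀ t ∈ Icc t₀ T', ∀ x ∈ ball x₁ (R / 2), cylRadius x ≤ Real.sqrt (T - t) →
          |swirl (v t) x| ≤ K' * cylRadius x / Real.sqrt (T - t) := by
  obtain ⟨K, A, hK0, hA0, hmain⟩ :=
    exists_swirl_le_swirlBarrier (T := T) (t₀ := t₀) hν ht₀T hC hCΓ hV₀ hF₀ (half_pos hR)
  refine ⟨K + A, by positivity, ?_⟩
  intro T' v f q x₁ ht₀ hT' hcl haxi hfaxi hx₁ hmer hΓ hV₀b hF₀b t ht x hx hrl
  set a : ℝ := (C + 1) / ν with ha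
  have ha0 : 0 < a := by rw [ha]; positivity
  -- the foot of `x` on the axis and the balls around it
  set c : (EuclideanSpace ℝ (Fin 3)) := EuclideanSpace.single (2 : Fin 3) (x 2) with hcdef
  have hc : cylRadius c = 0 := cylRadius_axisFoot x
  have hxc : ‖x - c‖ = cylRadius x := norm_sub_axisFoot x
  have hcx₁ : ‖c - x₁‖ < R / 2 :=
    lt_of_le_of_lt (norm_axisFoot_sub_le hx₁ x) (mem_ball_iff_norm.1 hx)
  have hball : ball c (R / 2) ⊆ ball x₁ R := fun y hy => by
    rw [mem_ball_iff_norm] at hy ⊢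
    calc ‖y - x₁‖ = ‖(y - c) + (c - x₁)‖ := by rw [sub_add_sub_cancel]
      _ ≤ ‖y - c‖ + ‖c - x₁‖ := norm_add_le _ _
      _ < R := by linarith
  have hcball : closedBall c (R / 2) ⊆ closedBall x₁ R := fun y hy => by
    rw [mem_closedBall_iff_norm] at hy ⊢
    calc ‖y - x₁‖ = ‖(y - c) + (c - x₁)‖ := by rw [sub_add_sub_cancel]
      _ ≤ ‖y - c‖ + ‖c - x₁‖ := norm_add_le _ _
      _ ≤ R := by linarith
  have hdrift : ∀ s ∈ Icc t₀ T', ∀ y ∈ ball c (R / 2),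
      |⟪y - c, v s y⟫| ≤ C * ‖y - c‖ / Real.sqrt (T - s) := by
    intro s hs y hy
    rw [inner_sub_axisPoint_eq_inner_poloidalPart hc]
    calc |⟪y - c, poloidalPart (v s) y⟫| ≤ ‖y - c‖ * ‖poloidalPart (v s) y‖ :=
          abs_real_inner_le_norm _ _
      _ ≤ ‖y - c‖ * (C / Real.sqrt (T - s)) :=
          mul_le_mul_of_nonneg_left (hmer s hs y (hball hy)) (norm_nonneg _)
      _ = C * ‖y - c‖ / Real.sqrt (T - s) := by ring
  have hxmem : x ∈ closedBall c (R / 2) := by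
    rw [mem_closedBall_iff_norm, hxc]
    exact (cylRadius_le_norm_sub_axisPoint hx₁ x).trans (mem_ball_iff_norm.1 hx).le
  have hb := hmain T' v f q c ht₀ hT' hcl haxi hfaxi hc hdrift
    (fun s hs y hy => hΓ s hs y (hcball hy)) (fun y hy => hV₀b y (hcball hy))
    (fun s hs y hy => hF₀b s hs y (hball hy)) t ht x hxmem
  rw [hxc] at hb
  -- inside the parabola: `Ψ_a(s) ≤ s`, `s² ≤ s`
  have hgap : 0 < T - t := by linarith [ht.2]
  set lam : ℝ := Real.sqrt (T - t) with hlam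
  have hlam0 : 0 < lam := Real.sqrt_pos.2 hgap
  have hlam2 : lam ^ 2 = T - t := Real.sq_sqrt hgap.le
  set r : ℝ := cylRadius x with hrdef
  have hr0 : 0 ≤ r := cylRadius_nonneg x
  have hs1 : r / lam ≤ 1 := (div_le_one hlam0).2 hrl
  have hΨ : (1 - Real.exp (-(a * (r / lam)))) / a ≤ r / lam := swirlProfile_le_self ha0 _
  have hq : r ^ 2 / (T - t) ≤ r / lam := by
    rw [← hlam2, show r ^ 2 / lam ^ 2 = (r / lam) * (r / lam) by ring]
    have hs0 : 0 ≤ r / lam := by positivity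
    nlinarith
  have h2 := mul_le_mul_of_nonneg_left hΨ hK0
  have h3 : A * r ^ 2 / (T - t) ≤ A * (r / lam) := by
    rw [mul_div_assoc]; exact mul_le_mul_of_nonneg_left hq hA0
  calc |swirl (v t) x| ≤ K * ((1 - Real.exp (-(a * (r / lam)))) / a) + A * r ^ 2 / (T - t) := hb
    _ ≤ K * (r / lam) + A * (r / lam) := add_le_add h2 h3
    _ = (K + A) * r / lam := by ring

/-- **THE MERIDIONAL TYPE-I BOUND IMPLIES THE FULL TYPE-I BOUND, LOCALLY AT THE AXIS** (classical,
with force; the quantitative form of "oversimplifying slightly, we can replace `v̄` by `v` in our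
assumptions", Seregin–Šverák 2009, p. 4 — here for the TYPE-I RATE (1.1), by the swirl barrier
instead of the local energy method): there is `C'`, depending on `ν, C, C_Γ, V₀, F₀, R, T − t₀`
only, such that under the hypotheses of `exists_swirl_le_linear_cylRadius`, for every `T' < T`,
`t ∈ [t₀, T']` and `x ∈ B(x₁, R/2)`: `|u(t, x)| ≤ C'/√(T − t)`. Proof: `|u| ≤ |ū| + |u_θ|`;
inside the parabola `r ≤ √(T − t)` the barrier gives `|Γ| ≤ K' r/√(T − t)`, outside it the swirl
bound gives `|u_θ| = |Γ|/r ≤ C_Γ/√(T − t)`; `C' = C + K' + C_Γ`.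
[cite: SereginSverak2009, §1 (1.1) and Thm 1.1 (arXiv pp. 2–4)] -/
theorem exists_norm_le_typeI_of_meridionalTypeI {T t₀ ν C CΓ V₀ F₀ R : ℝ} (hν : 0 < ν)
    (ht₀T : t₀ < T) (hC : 0 ≤ C) (hCΓ : 0 ≤ CΓ) (hV₀ : 0 ≤ V₀) (hF₀ : 0 ≤ F₀) (hR : 0 < R) :
    ∃ C' : ℝ, 0 ≤ C' ∧
      ∀ (T' : ℝ) (v f : ℝ → (EuclideanSpace ℝ (Fin 3)) → (EuclideanSpace ℝ (Fin 3))) (q : ℝ → (EuclideanSpace ℝ (Fin 3)) → ℝ) (x₁ : (EuclideanSpace ℝ (Fin 3))), t₀ < T' → T' < T →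
        IsClassicalNSSolutionOn (Icc t₀ T') ν f v q →
        (∀ t ∈ Icc t₀ T', IsAxisymmetric (v t)) → (∀ t ∈ Icc t₀ T', IsAxisymmetric (f t)) →
        cylRadius x₁ = 0 →
        (∀ t ∈ Icc t₀ T', ∀ x ∈ ball x₁ R, ‖poloidalPart (v t) x‖ ≤ C / Real.sqrt (T - t)) →
        (∀ t ∈ Icc t₀ T', ∀ x ∈ closedBall x₁ R, |swirl (v t) x| ≤ CΓ) →
        (∀ x ∈ closedBall x₁ R, ‖v t₀ x‖ ≤ V₀) →
        (∀ t ∈ Icc t₀ T', ∀ x ∈ ball x₁ R, ‖f t x‖ ≤ F₀) →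
        ∀ t ∈ Icc t₀ T', ∀ x ∈ ball x₁ (R / 2), ‖v t x‖ ≤ C' / Real.sqrt (T - t) := by
  obtain ⟨K', hK'0, hlin⟩ :=
    exists_swirl_le_linear_cylRadius (T := T) (t₀ := t₀) hν ht₀T hC hCΓ hV₀ hF₀ hR
  refine ⟨C + K' + CΓ, by positivity, ?_⟩
  intro T' v f q x₁ ht₀ hT' hcl haxi hfaxi hx₁ hmer hΓ hV₀b hF₀b t ht x hx
  have hgap : 0 < T - t := by linarith [ht.2]
  set lam : ℝ := Real.sqrt (T - t) with hlam
  have hlam0 : 0 < lam := Real.sqrt_pos.2 hgap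
  have hxR : x ∈ ball x₁ R := ball_subset_ball (by linarith) hx
  have hmer' : ‖poloidalPart (v t) x‖ ≤ C / lam := hmer t ht x hxR
  -- the swirl part: `|u_θ| ≤ (K' + C_Γ)/λ`
  have hθ : |swirlVelocity (v t) x| ≤ (K' + CΓ) / lam := by
    by_cases hr : cylRadius x = 0
    · have h1 : swirlVelocity (v t) x = 0 := by simp [swirlVelocity, eTheta, hr]
      rw [h1, abs_zero]; positivity
    · have hr0 : 0 < cylRadius x := lt_of_le_of_ne (cylRadius_nonneg x) (Ne.symm hr)
      set r : ℝ := cylRadius x with hrdef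
      have hsv : |swirlVelocity (v t) x| = |swirl (v t) x| / r := by
        rw [swirl_eq_cylRadius_mul_swirlVelocity (v t) hr, abs_mul, abs_of_pos hr0]
        field_simp
      rw [hsv, div_le_div_iff₀ hr0 hlam0]
      by_cases hrl : r ≤ lam
      · have hb := hlin T' v f q x₁ ht₀ hT' hcl haxi hfaxi hx₁ hmer hΓ hV₀b hF₀b t ht x hx hrl
        rw [← hrdef, ← hlam] at hb
        have h4 : K' * r / lam * lam = K' * r := by field_simp
        calc |swirl (v t) x| * lam ≤ K' * r / lam * lam := mul_le_mul_of_nonneg_right hb hlam0.le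
          _ = K' * r := h4
          _ ≤ (K' + CΓ) * r := by nlinarith
      · push Not at hrl
        have h1 : |swirl (v t) x| ≤ CΓ := hΓ t ht x (ball_subset_closedBall hxR)
        calc |swirl (v t) x| * lam ≤ CΓ * r := by
              have := mul_le_mul h1 hrl.le hlam0.le hCΓ
              linarith
          _ ≤ (K' + CΓ) * r := by nlinarith
  calc ‖v t x‖ ≤ ‖poloidalPart (v t) x‖ + |swirlVelocity (v t) x| :=
        SereginSverak2009.norm_le_norm_poloidalPart_add_abs_swirlVelocity (v t) x
    _ ≤ C / lam + (K' + CΓ) / lam := add_le_add hmer' hθ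
    _ = (C + K' + CΓ) / lam := by ring

end Meridional

end Summit.NavierStokesRegularity.FluidComputer

end
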